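import Literature.Algebra.Polynomial.CasasAlvero.Char547Digits
import Literature.Algebra.Polynomial.CasasAlvero.Char547DigitsHigh
import Literature.Algebra.Polynomial.CasasAlvero.Char547DigitsTop
import Literature.Algebra.Polynomial.CasasAlvero.Char547DigitsPeak
import Literature.Algebra.Polynomial.CasasAlvero.Degree7Char547
import Literature.Algebra.Polynomial.CasasAlvero.Pentanomial
import Literature.Algebra.Polynomial.CasasAlvero.Degree6CandidatesPrime
import Literature.Algebra.Polynomial.CasasAlvero.FieldCorollaries
import Literature.Algebra.Polynomial.CasasAlvero.Degree5
import Literature.Algebra.Polynomial.CasasAlvero.Degree6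
import Literature.Algebra.Polynomial.CasasAlvero.DigitReduction
import HarnessLib

/-!
# Casas-Alvero degrees in characteristic 547: the classification away from the digit `8`

Over EVERY field `K` of characteristic `547` and for every degree `d` that is NOT of the form `8·547^k`:
`CA_d(K) ⟺ d = 0 ∨ d = a·547^k` with `1 ≤ a ≤ 7`.  The one digit left out of this file is `a = 8`, for the following reason.  Every bad digit in this
tree is refuted by an explicit `𝔽_p`-rational sparse polynomial with `𝔽_p`-rational witnesses (which lives in every field of characteristic `p`), but the
EXHAUSTIVE search of the translated–scaled normal form `X^8 + a_6 X^6 + … + a_1 X` over `𝔽_547`, in the exhaustive support-enumeration implementation `cls/wsub/wsub.py 547:8` (every support of size `≤ 6`,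
witness-subset linear algebra; two independent runs; kit jobs j145873, j147818), returns NOTHING: there is no Casas-Alvero octic over `𝔽_547` all of whose Hasse-derivative witnesses lie in
`𝔽_547`.  Consequently `CA_8` cannot be refuted uniformly over all fields of characteristic `547` by this method (indeed the search says that `CA_8` holds over
the prime field `𝔽_547` itself — a computational statement NOT formalised here), and whether `CA_8` holds over the algebraic closure of `𝔽_547` (whether `547`
is a good prime of degree `8` in the sense of [CastryckLaterveerOunaies2012]) is decided SEPARATELY, in the affirmative, by the `876` kernel-checked scenario certificates of `Degree8Char547Cert01.lean` … `Degree8Char547Cert18.lean` assembled in `Degree8Char547.lean` (`holdsInDegree_eight_of_char_547`: `CA_8` HOLDS over every field of characteristic `547`, so `547` is a GOOD prime for degree `8` and the digit `8` is genuinely positive — which is why no refuting example can exist); `CharFiveHundredFortySevenComplete.lean` combines that theorem with this file into the complete classification (digit set `{1, 2, 3, 4, 5, 6, 7, 8}`).  This file is the example-based half and carves the digit `8` out.  Nothing below depends on the outcome.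
Ingredients: the digit reduction `CA_d ⇒ d = a·p^k ∧ CA_a` (`DigitReduction.lean`, any field); the positive digits `1, 2, 3, 4`
([GrafVonBothmerEtAl2007, Props. 2, 6]), `5` (`Degree5.lean`: `547` is not one of the nine bad primes of degree `5`), `6` (`547` is not among the `54`
candidate bad primes of degree `6` of `Degree6CandidatesPrime.lean`, so `CA_6` holds in characteristic `547` [CastryckLaterveerOunaies2012, Thm. 4]) and `7`
(`Degree7Char547.lean`: `547` is a GOOD prime for degree `7` — the kernel-checked scenario certificates `holdsInDegree_seven_of_char_547`; the bad primes of
degree `7` were computed in [CastryckLaterveerOunaies2012, Thm. 4]); and a refutation of every digit `9 ≤ a ≤ 546` over every field of characteristic `547`: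
`88, 91, 96, 127, 136, 152, 153, 164, 181, 190, 193, 199, 203, 205, 208, 220, 227, 235, 243, 246, 248, 249, 251, 256, 260, 272, 277, 278, 281, 295, 297, 298, 304, 313, 319, 320, 322, 323, 324, 330, 336, 339, 344, 345, 346, 347, 348, 350, 352, 354, 357, 360, 363, 371, 373, 375, 380, 385, 387, 399, 406, 407, 409, 411, 427, 428, 431, 437, 438, 439, 445, 452, 457, 459, 460, 462, 469, 470, 476, 478, 482, 493, 494, 496, 497, 498, 501, 504, 507, 508, 514, 518, 521, 522, 525, 529, 533, 534, 536, 541, 543, 546` by the binomial criterion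
(`m = 19, 17, 32, 18, 5, 68, 34, 24, 44, 3, 77, 49, 56, 13, 53, 89, 45, 107, 70, 101, 50, 49, 101, 53, 38, 79, 12, 52, 12, 96, 5, 23, 118, 112, 25, 52, 79, 152, 38, 77, 147, 139, 141, 112, 55, 96, 50, 163, 151, 86, 3, 118, 180, 87, 70, 152, 123, 135, 53, 56, 24, 200, 44, 21, 34, 186, 166, 18, 73, 128, 150, 21, 49, 175, 192, 68, 116, 97, 119, 84, 32, 159, 226, 198, 89, 117, 182, 181, 227, 222, 64, 53, 227, 140, 135, 74, 192, 237, 209, 249, 189, 2`); and the 436 remaining digits by the sparse `𝔽_547`-examples of `Char547Digits.lean`, `Char547DigitsHigh.lean`, `Char547DigitsTop.lean` and `Char547DigitsPeak.lean`.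
-/

noncomputable section

open Polynomial

set_option maxRecDepth 8192

namespace Literature.Algebra.Polynomial.CasasAlvero

section CharFiveHundredFortySevenPartial

variable (K : Type*) [Field K] [CharP K 547]

/-- `CA_{6·547^k}` over every field of characteristic `547` (`CA_6` itself — the case `k = 0` — holds because `547` is not among the
`54` candidate bad primes of degree `6` of `Degree6CandidatesPrime.lean`, `holdsInDegree_six_of_not_mem`, i.e. `547` is a GOOD prime for degree `6`
[cite: CastryckLaterveerOunaies2012, Thm. 4]). [cite: GrafVonBothmerEtAl2007, Prop. 6] -/
theorem holdsInDegree_six_mul_pow_of_char_547' (k : ℕ) : HoldsInDegree K (6 * 547 ^ k) := by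
  haveI : Fact (Nat.Prime 547) := ⟨by norm_num⟩
  exact holdsInDegree_mul_prime_pow_field K 547 (holdsInDegree_six_of_not_mem (K := AlgebraicClosure K) 547 (by decide)) k

set_option maxHeartbeats 0 in
/-- every digit `9 ≤ a < 547` other than `8` fails: `¬ CA_a` over every field of characteristic `547` — the bad-prime computations of
[cite: CastryckLaterveerOunaies2012, Thm. 4] (degrees `≤ 7`) extended to these digits by explicit `𝔽_547`-rational examples and the
binomial criterion (the digit `8` has no `𝔽_547`-rational-witness example and is not treated). [cite: GrafVonBothmerEtAl2007, Prop. 6] -/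
theorem not_holdsInDegree_digit_of_char_fiveHundredFortySeven' {a : ℕ} (hlo : 9 ≤ a) (hap : a < 547) (h8 : a ≠ 8) : ¬ HoldsInDegree K a := by
  haveI : Fact (Nat.Prime 547) := ⟨by norm_num⟩
  interval_cases a
  · exact not_holdsInDegree_nine_of_char_547 K
  · exact not_holdsInDegree_ten_of_char_547 K
  · exact not_holdsInDegree_eleven_of_char_547 K
  · exact not_holdsInDegree_twelve_of_char_547 K
  · exact not_holdsInDegree_thirteen_of_char_547 K
  · exact not_holdsInDegree_fourteen_of_char_547 K
  · exact not_holdsInDegree_fifteen_of_char_547 K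
  · exact not_holdsInDegree_sixteen_of_char_547 K
  · exact not_holdsInDegree_seventeen_of_char_547 K
  · exact not_holdsInDegree_eighteen_of_char_547 K
  · exact not_holdsInDegree_nineteen_of_char_547 K
  · exact not_holdsInDegree_twenty_of_char_547 K
  · exact not_holdsInDegree_twentyOne_of_char_547 K
  · exact not_holdsInDegree_twentyTwo_of_char_547 K
  · exact not_holdsInDegree_twentyThree_of_char_547 K
  · exact not_holdsInDegree_twentyFour_of_char_547 K
  · exact not_holdsInDegree_twentyFive_of_char_547 K
  · exact not_holdsInDegree_twentySix_of_char_547 K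
  · exact not_holdsInDegree_twentySeven_of_char_547 K
  · exact not_holdsInDegree_twentyEight_of_char_547 K
  · exact not_holdsInDegree_twentyNine_of_char_547 K
  · exact not_holdsInDegree_thirty_of_char_547 K
  · exact not_holdsInDegree_thirtyOne_of_char_547 K
  · exact not_holdsInDegree_thirtyTwo_of_char_547 K
  · exact not_holdsInDegree_thirtyThree_of_char_547 K
  · exact not_holdsInDegree_thirtyFour_of_char_547 K
  · exact not_holdsInDegree_thirtyFive_of_char_547 K
  · exact not_holdsInDegree_thirtySix_of_char_547 K
  · exact not_holdsInDegree_thirtySeven_of_char_547 K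
  · exact not_holdsInDegree_thirtyEight_of_char_547 K
  · exact not_holdsInDegree_thirtyNine_of_char_547 K
  · exact not_holdsInDegree_forty_of_char_547 K
  · exact not_holdsInDegree_fortyOne_of_char_547 K
  · exact not_holdsInDegree_fortyTwo_of_char_547 K
  · exact not_holdsInDegree_fortyThree_of_char_547 K
  · exact not_holdsInDegree_fortyFour_of_char_547 K
  · exact not_holdsInDegree_fortyFive_of_char_547 K
  · exact not_holdsInDegree_fortySix_of_char_547 K
  · exact not_holdsInDegree_fortySeven_of_char_547 K
  · exact not_holdsInDegree_fortyEight_of_char_547 K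
  · exact not_holdsInDegree_fortyNine_of_char_547 K
  · exact not_holdsInDegree_fifty_of_char_547 K
  · exact not_holdsInDegree_fiftyOne_of_char_547 K
  · exact not_holdsInDegree_fiftyTwo_of_char_547 K
  · exact not_holdsInDegree_fiftyThree_of_char_547 K
  · exact not_holdsInDegree_fiftyFour_of_char_547 K
  · exact not_holdsInDegree_fiftyFive_of_char_547 K
  · exact not_holdsInDegree_fiftySix_of_char_547 K
  · exact not_holdsInDegree_fiftySeven_of_char_547 K
  · exact not_holdsInDegree_fiftyEight_of_char_547 K
  · exact not_holdsInDegree_fiftyNine_of_char_547 K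
  · exact not_holdsInDegree_sixty_of_char_547 K
  · exact not_holdsInDegree_sixtyOne_of_char_547 K
  · exact not_holdsInDegree_sixtyTwo_of_char_547 K
  · exact not_holdsInDegree_sixtyThree_of_char_547 K
  · exact not_holdsInDegree_sixtyFour_of_char_547 K
  · exact not_holdsInDegree_sixtyFive_of_char_547 K
  · exact not_holdsInDegree_sixtySix_of_char_547 K
  · exact not_holdsInDegree_sixtySeven_of_char_547 K
  · exact not_holdsInDegree_sixtyEight_of_char_547 K
  · exact not_holdsInDegree_sixtyNine_of_char_547 K
  · exact not_holdsInDegree_seventy_of_char_547 K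
  · exact not_holdsInDegree_seventyOne_of_char_547 K
  · exact not_holdsInDegree_seventyTwo_of_char_547 K
  · exact not_holdsInDegree_seventyThree_of_char_547 K
  · exact not_holdsInDegree_seventyFour_of_char_547 K
  · exact not_holdsInDegree_seventyFive_of_char_547 K
  · exact not_holdsInDegree_seventySix_of_char_547 K
  · exact not_holdsInDegree_seventySeven_of_char_547 K
  · exact not_holdsInDegree_seventyEight_of_char_547 K
  · exact not_holdsInDegree_seventyNine_of_char_547 K
  · exact not_holdsInDegree_eighty_of_char_547 K
  · exact not_holdsInDegree_eightyOne_of_char_547 K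
  · exact not_holdsInDegree_eightyTwo_of_char_547 K
  · exact not_holdsInDegree_eightyThree_of_char_547 K
  · exact not_holdsInDegree_eightyFour_of_char_547 K
  · exact not_holdsInDegree_eightyFive_of_char_547 K
  · exact not_holdsInDegree_eightySix_of_char_547 K
  · exact not_holdsInDegree_eightySeven_of_char_547 K
  · exact not_holdsInDegree_of_choose_modEq_one K 547 (d := 88) (m := 19) (by norm_num) (by norm_num) (by decide)
  · exact not_holdsInDegree_eightyNine_of_char_547 K
  · exact not_holdsInDegree_ninety_of_char_547 K
  · exact not_holdsInDegree_of_choose_modEq_one K 547 (d := 91) (m := 17) (by norm_num) (by norm_num) (by decide)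
  · exact not_holdsInDegree_ninetyTwo_of_char_547 K
  · exact not_holdsInDegree_ninetyThree_of_char_547 K
  · exact not_holdsInDegree_ninetyFour_of_char_547 K
  · exact not_holdsInDegree_ninetyFive_of_char_547 K
  · exact not_holdsInDegree_of_choose_modEq_one K 547 (d := 96) (m := 32) (by norm_num) (by norm_num) (by decide)
  · exact not_holdsInDegree_ninetySeven_of_char_547 K
  · exact not_holdsInDegree_ninetyEight_of_char_547 K
  · exact not_holdsInDegree_ninetyNine_of_char_547 K
  · exact not_holdsInDegree_oneHundred_of_char_547 K
  · exact not_holdsInDegree_oneHundredOne_of_char_547 K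
  · exact not_holdsInDegree_oneHundredTwo_of_char_547 K
  · exact not_holdsInDegree_oneHundredThree_of_char_547 K
  · exact not_holdsInDegree_oneHundredFour_of_char_547 K
  · exact not_holdsInDegree_oneHundredFive_of_char_547 K
  · exact not_holdsInDegree_oneHundredSix_of_char_547 K
  · exact not_holdsInDegree_oneHundredSeven_of_char_547 K
  · exact not_holdsInDegree_oneHundredEight_of_char_547 K
  · exact not_holdsInDegree_oneHundredNine_of_char_547 K
  · exact not_holdsInDegree_oneHundredTen_of_char_547 K
  · exact not_holdsInDegree_oneHundredEleven_of_char_547 K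
  · exact not_holdsInDegree_oneHundredTwelve_of_char_547 K
  · exact not_holdsInDegree_oneHundredThirteen_of_char_547 K
  · exact not_holdsInDegree_oneHundredFourteen_of_char_547 K
  · exact not_holdsInDegree_oneHundredFifteen_of_char_547 K
  · exact not_holdsInDegree_oneHundredSixteen_of_char_547 K
  · exact not_holdsInDegree_oneHundredSeventeen_of_char_547 K
  · exact not_holdsInDegree_oneHundredEighteen_of_char_547 K
  · exact not_holdsInDegree_oneHundredNineteen_of_char_547 K
  · exact not_holdsInDegree_oneHundredTwenty_of_char_547 K
  · exact not_holdsInDegree_oneHundredTwentyOne_of_char_547 K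
  · exact not_holdsInDegree_oneHundredTwentyTwo_of_char_547 K
  · exact not_holdsInDegree_oneHundredTwentyThree_of_char_547 K
  · exact not_holdsInDegree_oneHundredTwentyFour_of_char_547 K
  · exact not_holdsInDegree_oneHundredTwentyFive_of_char_547 K
  · exact not_holdsInDegree_oneHundredTwentySix_of_char_547 K
  · exact not_holdsInDegree_of_choose_modEq_one K 547 (d := 127) (m := 18) (by norm_num) (by norm_num) (by decide)
  · exact not_holdsInDegree_oneHundredTwentyEight_of_char_547 K
  · exact not_holdsInDegree_oneHundredTwentyNine_of_char_547 K
  · exact not_holdsInDegree_oneHundredThirty_of_char_547 K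
  · exact not_holdsInDegree_oneHundredThirtyOne_of_char_547 K
  · exact not_holdsInDegree_oneHundredThirtyTwo_of_char_547 K
  · exact not_holdsInDegree_oneHundredThirtyThree_of_char_547 K
  · exact not_holdsInDegree_oneHundredThirtyFour_of_char_547 K
  · exact not_holdsInDegree_oneHundredThirtyFive_of_char_547 K
  · exact not_holdsInDegree_of_choose_modEq_one K 547 (d := 136) (m := 5) (by norm_num) (by norm_num) (by decide)
  · exact not_holdsInDegree_oneHundredThirtySeven_of_char_547 K
  · exact not_holdsInDegree_oneHundredThirtyEight_of_char_547 K
  · exact not_holdsInDegree_oneHundredThirtyNine_of_char_547 K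
  · exact not_holdsInDegree_oneHundredForty_of_char_547 K
  · exact not_holdsInDegree_oneHundredFortyOne_of_char_547 K
  · exact not_holdsInDegree_oneHundredFortyTwo_of_char_547 K
  · exact not_holdsInDegree_oneHundredFortyThree_of_char_547 K
  · exact not_holdsInDegree_oneHundredFortyFour_of_char_547 K
  · exact not_holdsInDegree_oneHundredFortyFive_of_char_547 K
  · exact not_holdsInDegree_oneHundredFortySix_of_char_547 K
  · exact not_holdsInDegree_oneHundredFortySeven_of_char_547 K
  · exact not_holdsInDegree_oneHundredFortyEight_of_char_547 K
  · exact not_holdsInDegree_oneHundredFortyNine_of_char_547 K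
  · exact not_holdsInDegree_oneHundredFifty_of_char_547 K
  · exact not_holdsInDegree_oneHundredFiftyOne_of_char_547 K
  · exact not_holdsInDegree_of_choose_modEq_one K 547 (d := 152) (m := 68) (by norm_num) (by norm_num) (by decide)
  · exact not_holdsInDegree_of_choose_modEq_one K 547 (d := 153) (m := 34) (by norm_num) (by norm_num) (by decide)
  · exact not_holdsInDegree_oneHundredFiftyFour_of_char_547 K
  · exact not_holdsInDegree_oneHundredFiftyFive_of_char_547 K
  · exact not_holdsInDegree_oneHundredFiftySix_of_char_547 K
  · exact not_holdsInDegree_oneHundredFiftySeven_of_char_547 K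
  · exact not_holdsInDegree_oneHundredFiftyEight_of_char_547 K
  · exact not_holdsInDegree_oneHundredFiftyNine_of_char_547 K
  · exact not_holdsInDegree_oneHundredSixty_of_char_547 K
  · exact not_holdsInDegree_oneHundredSixtyOne_of_char_547 K
  · exact not_holdsInDegree_oneHundredSixtyTwo_of_char_547 K
  · exact not_holdsInDegree_oneHundredSixtyThree_of_char_547 K
  · exact not_holdsInDegree_of_choose_modEq_one K 547 (d := 164) (m := 24) (by norm_num) (by norm_num) (by decide)
  · exact not_holdsInDegree_oneHundredSixtyFive_of_char_547 K
  · exact not_holdsInDegree_oneHundredSixtySix_of_char_547 K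
  · exact not_holdsInDegree_oneHundredSixtySeven_of_char_547 K
  · exact not_holdsInDegree_oneHundredSixtyEight_of_char_547 K
  · exact not_holdsInDegree_oneHundredSixtyNine_of_char_547 K
  · exact not_holdsInDegree_oneHundredSeventy_of_char_547 K
  · exact not_holdsInDegree_oneHundredSeventyOne_of_char_547 K
  · exact not_holdsInDegree_oneHundredSeventyTwo_of_char_547 K
  · exact not_holdsInDegree_oneHundredSeventyThree_of_char_547 K
  · exact not_holdsInDegree_oneHundredSeventyFour_of_char_547 K
  · exact not_holdsInDegree_oneHundredSeventyFive_of_char_547 K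
  · exact not_holdsInDegree_oneHundredSeventySix_of_char_547 K
  · exact not_holdsInDegree_oneHundredSeventySeven_of_char_547 K
  · exact not_holdsInDegree_oneHundredSeventyEight_of_char_547 K
  · exact not_holdsInDegree_oneHundredSeventyNine_of_char_547 K
  · exact not_holdsInDegree_oneHundredEighty_of_char_547 K
  · exact not_holdsInDegree_of_choose_modEq_one K 547 (d := 181) (m := 44) (by norm_num) (by norm_num) (by decide)
  · exact not_holdsInDegree_oneHundredEightyTwo_of_char_547 K
  · exact not_holdsInDegree_oneHundredEightyThree_of_char_547 K
  · exact not_holdsInDegree_oneHundredEightyFour_of_char_547 K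
  · exact not_holdsInDegree_oneHundredEightyFive_of_char_547 K
  · exact not_holdsInDegree_oneHundredEightySix_of_char_547 K
  · exact not_holdsInDegree_oneHundredEightySeven_of_char_547 K
  · exact not_holdsInDegree_oneHundredEightyEight_of_char_547 K
  · exact not_holdsInDegree_oneHundredEightyNine_of_char_547 K
  · exact not_holdsInDegree_of_choose_modEq_one K 547 (d := 190) (m := 3) (by norm_num) (by norm_num) (by decide)
  · exact not_holdsInDegree_oneHundredNinetyOne_of_char_547 K
  · exact not_holdsInDegree_oneHundredNinetyTwo_of_char_547 K
  · exact not_holdsInDegree_of_choose_modEq_one K 547 (d := 193) (m := 77) (by norm_num) (by norm_num) (by decide)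
  · exact not_holdsInDegree_oneHundredNinetyFour_of_char_547 K
  · exact not_holdsInDegree_oneHundredNinetyFive_of_char_547 K
  · exact not_holdsInDegree_oneHundredNinetySix_of_char_547 K
  · exact not_holdsInDegree_oneHundredNinetySeven_of_char_547 K
  · exact not_holdsInDegree_oneHundredNinetyEight_of_char_547 K
  · exact not_holdsInDegree_of_choose_modEq_one K 547 (d := 199) (m := 49) (by norm_num) (by norm_num) (by decide)
  · exact not_holdsInDegree_twoHundred_of_char_547 K
  · exact not_holdsInDegree_twoHundredOne_of_char_547 K
  · exact not_holdsInDegree_twoHundredTwo_of_char_547 K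
  · exact not_holdsInDegree_of_choose_modEq_one K 547 (d := 203) (m := 56) (by norm_num) (by norm_num) (by decide)
  · exact not_holdsInDegree_twoHundredFour_of_char_547 K
  · exact not_holdsInDegree_of_choose_modEq_one K 547 (d := 205) (m := 13) (by norm_num) (by norm_num) (by decide)
  · exact not_holdsInDegree_twoHundredSix_of_char_547 K
  · exact not_holdsInDegree_twoHundredSeven_of_char_547 K
  · exact not_holdsInDegree_of_choose_modEq_one K 547 (d := 208) (m := 53) (by norm_num) (by norm_num) (by decide)
  · exact not_holdsInDegree_twoHundredNine_of_char_547 K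
  · exact not_holdsInDegree_twoHundredTen_of_char_547 K
  · exact not_holdsInDegree_twoHundredEleven_of_char_547 K
  · exact not_holdsInDegree_twoHundredTwelve_of_char_547 K
  · exact not_holdsInDegree_twoHundredThirteen_of_char_547 K
  · exact not_holdsInDegree_twoHundredFourteen_of_char_547 K
  · exact not_holdsInDegree_twoHundredFifteen_of_char_547 K
  · exact not_holdsInDegree_twoHundredSixteen_of_char_547 K
  · exact not_holdsInDegree_twoHundredSeventeen_of_char_547 K
  · exact not_holdsInDegree_twoHundredEighteen_of_char_547 K
  · exact not_holdsInDegree_twoHundredNineteen_of_char_547 K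
  · exact not_holdsInDegree_of_choose_modEq_one K 547 (d := 220) (m := 89) (by norm_num) (by norm_num) (by decide)
  · exact not_holdsInDegree_twoHundredTwentyOne_of_char_547 K
  · exact not_holdsInDegree_twoHundredTwentyTwo_of_char_547 K
  · exact not_holdsInDegree_twoHundredTwentyThree_of_char_547 K
  · exact not_holdsInDegree_twoHundredTwentyFour_of_char_547 K
  · exact not_holdsInDegree_twoHundredTwentyFive_of_char_547 K
  · exact not_holdsInDegree_twoHundredTwentySix_of_char_547 K
  · exact not_holdsInDegree_of_choose_modEq_one K 547 (d := 227) (m := 45) (by norm_num) (by norm_num) (by decide)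
  · exact not_holdsInDegree_twoHundredTwentyEight_of_char_547 K
  · exact not_holdsInDegree_twoHundredTwentyNine_of_char_547 K
  · exact not_holdsInDegree_twoHundredThirty_of_char_547 K
  · exact not_holdsInDegree_twoHundredThirtyOne_of_char_547 K
  · exact not_holdsInDegree_twoHundredThirtyTwo_of_char_547 K
  · exact not_holdsInDegree_twoHundredThirtyThree_of_char_547 K
  · exact not_holdsInDegree_twoHundredThirtyFour_of_char_547 K
  · exact not_holdsInDegree_of_choose_modEq_one K 547 (d := 235) (m := 107) (by norm_num) (by norm_num) (by decide)
  · exact not_holdsInDegree_twoHundredThirtySix_of_char_547 K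
  · exact not_holdsInDegree_twoHundredThirtySeven_of_char_547 K
  · exact not_holdsInDegree_twoHundredThirtyEight_of_char_547 K
  · exact not_holdsInDegree_twoHundredThirtyNine_of_char_547 K
  · exact not_holdsInDegree_twoHundredForty_of_char_547 K
  · exact not_holdsInDegree_twoHundredFortyOne_of_char_547 K
  · exact not_holdsInDegree_twoHundredFortyTwo_of_char_547 K
  · exact not_holdsInDegree_of_choose_modEq_one K 547 (d := 243) (m := 70) (by norm_num) (by norm_num) (by decide)
  · exact not_holdsInDegree_twoHundredFortyFour_of_char_547 K
  · exact not_holdsInDegree_twoHundredFortyFive_of_char_547 K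
  · exact not_holdsInDegree_of_choose_modEq_one K 547 (d := 246) (m := 101) (by norm_num) (by norm_num) (by decide)
  · exact not_holdsInDegree_twoHundredFortySeven_of_char_547 K
  · exact not_holdsInDegree_of_choose_modEq_one K 547 (d := 248) (m := 50) (by norm_num) (by norm_num) (by decide)
  · exact not_holdsInDegree_of_choose_modEq_one K 547 (d := 249) (m := 49) (by norm_num) (by norm_num) (by decide)
  · exact not_holdsInDegree_twoHundredFifty_of_char_547 K
  · exact not_holdsInDegree_of_choose_modEq_one K 547 (d := 251) (m := 101) (by norm_num) (by norm_num) (by decide)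
  · exact not_holdsInDegree_twoHundredFiftyTwo_of_char_547 K
  · exact not_holdsInDegree_twoHundredFiftyThree_of_char_547 K
  · exact not_holdsInDegree_twoHundredFiftyFour_of_char_547 K
  · exact not_holdsInDegree_twoHundredFiftyFive_of_char_547 K
  · exact not_holdsInDegree_of_choose_modEq_one K 547 (d := 256) (m := 53) (by norm_num) (by norm_num) (by decide)
  · exact not_holdsInDegree_twoHundredFiftySeven_of_char_547 K
  · exact not_holdsInDegree_twoHundredFiftyEight_of_char_547 K
  · exact not_holdsInDegree_twoHundredFiftyNine_of_char_547 K
  · exact not_holdsInDegree_of_choose_modEq_one K 547 (d := 260) (m := 38) (by norm_num) (by norm_num) (by decide)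
  · exact not_holdsInDegree_twoHundredSixtyOne_of_char_547 K
  · exact not_holdsInDegree_twoHundredSixtyTwo_of_char_547 K
  · exact not_holdsInDegree_twoHundredSixtyThree_of_char_547 K
  · exact not_holdsInDegree_twoHundredSixtyFour_of_char_547 K
  · exact not_holdsInDegree_twoHundredSixtyFive_of_char_547 K
  · exact not_holdsInDegree_twoHundredSixtySix_of_char_547 K
  · exact not_holdsInDegree_twoHundredSixtySeven_of_char_547 K
  · exact not_holdsInDegree_twoHundredSixtyEight_of_char_547 K
  · exact not_holdsInDegree_twoHundredSixtyNine_of_char_547 K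
  · exact not_holdsInDegree_twoHundredSeventy_of_char_547 K
  · exact not_holdsInDegree_twoHundredSeventyOne_of_char_547 K
  · exact not_holdsInDegree_of_choose_modEq_one K 547 (d := 272) (m := 79) (by norm_num) (by norm_num) (by decide)
  · exact not_holdsInDegree_twoHundredSeventyThree_of_char_547 K
  · exact not_holdsInDegree_twoHundredSeventyFour_of_char_547 K
  · exact not_holdsInDegree_twoHundredSeventyFive_of_char_547 K
  · exact not_holdsInDegree_twoHundredSeventySix_of_char_547 K
  · exact not_holdsInDegree_of_choose_modEq_one K 547 (d := 277) (m := 12) (by norm_num) (by norm_num) (by decide)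
  · exact not_holdsInDegree_of_choose_modEq_one K 547 (d := 278) (m := 52) (by norm_num) (by norm_num) (by decide)
  · exact not_holdsInDegree_twoHundredSeventyNine_of_char_547 K
  · exact not_holdsInDegree_twoHundredEighty_of_char_547 K
  · exact not_holdsInDegree_of_choose_modEq_one K 547 (d := 281) (m := 12) (by norm_num) (by norm_num) (by decide)
  · exact not_holdsInDegree_twoHundredEightyTwo_of_char_547 K
  · exact not_holdsInDegree_twoHundredEightyThree_of_char_547 K
  · exact not_holdsInDegree_twoHundredEightyFour_of_char_547 K
  · exact not_holdsInDegree_twoHundredEightyFive_of_char_547 K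
  · exact not_holdsInDegree_twoHundredEightySix_of_char_547 K
  · exact not_holdsInDegree_twoHundredEightySeven_of_char_547 K
  · exact not_holdsInDegree_twoHundredEightyEight_of_char_547 K
  · exact not_holdsInDegree_twoHundredEightyNine_of_char_547 K
  · exact not_holdsInDegree_twoHundredNinety_of_char_547 K
  · exact not_holdsInDegree_twoHundredNinetyOne_of_char_547 K
  · exact not_holdsInDegree_twoHundredNinetyTwo_of_char_547 K
  · exact not_holdsInDegree_twoHundredNinetyThree_of_char_547 K
  · exact not_holdsInDegree_twoHundredNinetyFour_of_char_547 K
  · exact not_holdsInDegree_of_choose_modEq_one K 547 (d := 295) (m := 96) (by norm_num) (by norm_num) (by decide)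
  · exact not_holdsInDegree_twoHundredNinetySix_of_char_547 K
  · exact not_holdsInDegree_of_choose_modEq_one K 547 (d := 297) (m := 5) (by norm_num) (by norm_num) (by decide)
  · exact not_holdsInDegree_of_choose_modEq_one K 547 (d := 298) (m := 23) (by norm_num) (by norm_num) (by decide)
  · exact not_holdsInDegree_twoHundredNinetyNine_of_char_547 K
  · exact not_holdsInDegree_threeHundred_of_char_547 K
  · exact not_holdsInDegree_threeHundredOne_of_char_547 K
  · exact not_holdsInDegree_threeHundredTwo_of_char_547 K
  · exact not_holdsInDegree_threeHundredThree_of_char_547 K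
  · exact not_holdsInDegree_of_choose_modEq_one K 547 (d := 304) (m := 118) (by norm_num) (by norm_num) (by decide)
  · exact not_holdsInDegree_threeHundredFive_of_char_547 K
  · exact not_holdsInDegree_threeHundredSix_of_char_547 K
  · exact not_holdsInDegree_threeHundredSeven_of_char_547 K
  · exact not_holdsInDegree_threeHundredEight_of_char_547 K
  · exact not_holdsInDegree_threeHundredNine_of_char_547 K
  · exact not_holdsInDegree_threeHundredTen_of_char_547 K
  · exact not_holdsInDegree_threeHundredEleven_of_char_547 K
  · exact not_holdsInDegree_threeHundredTwelve_of_char_547 K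
  · exact not_holdsInDegree_of_choose_modEq_one K 547 (d := 313) (m := 112) (by norm_num) (by norm_num) (by decide)
  · exact not_holdsInDegree_threeHundredFourteen_of_char_547 K
  · exact not_holdsInDegree_threeHundredFifteen_of_char_547 K
  · exact not_holdsInDegree_threeHundredSixteen_of_char_547 K
  · exact not_holdsInDegree_threeHundredSeventeen_of_char_547 K
  · exact not_holdsInDegree_threeHundredEighteen_of_char_547 K
  · exact not_holdsInDegree_of_choose_modEq_one K 547 (d := 319) (m := 25) (by norm_num) (by norm_num) (by decide)
  · exact not_holdsInDegree_of_choose_modEq_one K 547 (d := 320) (m := 52) (by norm_num) (by norm_num) (by decide)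
  · exact not_holdsInDegree_threeHundredTwentyOne_of_char_547 K
  · exact not_holdsInDegree_of_choose_modEq_one K 547 (d := 322) (m := 79) (by norm_num) (by norm_num) (by decide)
  · exact not_holdsInDegree_of_choose_modEq_one K 547 (d := 323) (m := 152) (by norm_num) (by norm_num) (by decide)
  · exact not_holdsInDegree_of_choose_modEq_one K 547 (d := 324) (m := 38) (by norm_num) (by norm_num) (by decide)
  · exact not_holdsInDegree_threeHundredTwentyFive_of_char_547 K
  · exact not_holdsInDegree_threeHundredTwentySix_of_char_547 K
  · exact not_holdsInDegree_threeHundredTwentySeven_of_char_547 K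
  · exact not_holdsInDegree_threeHundredTwentyEight_of_char_547 K
  · exact not_holdsInDegree_threeHundredTwentyNine_of_char_547 K
  · exact not_holdsInDegree_of_choose_modEq_one K 547 (d := 330) (m := 77) (by norm_num) (by norm_num) (by decide)
  · exact not_holdsInDegree_threeHundredThirtyOne_of_char_547 K
  · exact not_holdsInDegree_threeHundredThirtyTwo_of_char_547 K
  · exact not_holdsInDegree_threeHundredThirtyThree_of_char_547 K
  · exact not_holdsInDegree_threeHundredThirtyFour_of_char_547 K
  · exact not_holdsInDegree_threeHundredThirtyFive_of_char_547 K
  · exact not_holdsInDegree_of_choose_modEq_one K 547 (d := 336) (m := 147) (by norm_num) (by norm_num) (by decide)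
  · exact not_holdsInDegree_threeHundredThirtySeven_of_char_547 K
  · exact not_holdsInDegree_threeHundredThirtyEight_of_char_547 K
  · exact not_holdsInDegree_of_choose_modEq_one K 547 (d := 339) (m := 139) (by norm_num) (by norm_num) (by decide)
  · exact not_holdsInDegree_threeHundredForty_of_char_547 K
  · exact not_holdsInDegree_threeHundredFortyOne_of_char_547 K
  · exact not_holdsInDegree_threeHundredFortyTwo_of_char_547 K
  · exact not_holdsInDegree_threeHundredFortyThree_of_char_547 K
  · exact not_holdsInDegree_of_choose_modEq_one K 547 (d := 344) (m := 141) (by norm_num) (by norm_num) (by decide)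
  · exact not_holdsInDegree_of_choose_modEq_one K 547 (d := 345) (m := 112) (by norm_num) (by norm_num) (by decide)
  · exact not_holdsInDegree_of_choose_modEq_one K 547 (d := 346) (m := 55) (by norm_num) (by norm_num) (by decide)
  · exact not_holdsInDegree_of_choose_modEq_one K 547 (d := 347) (m := 96) (by norm_num) (by norm_num) (by decide)
  · exact not_holdsInDegree_of_choose_modEq_one K 547 (d := 348) (m := 50) (by norm_num) (by norm_num) (by decide)
  · exact not_holdsInDegree_threeHundredFortyNine_of_char_547 K
  · exact not_holdsInDegree_of_choose_modEq_one K 547 (d := 350) (m := 163) (by norm_num) (by norm_num) (by decide)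
  · exact not_holdsInDegree_threeHundredFiftyOne_of_char_547 K
  · exact not_holdsInDegree_of_choose_modEq_one K 547 (d := 352) (m := 151) (by norm_num) (by norm_num) (by decide)
  · exact not_holdsInDegree_threeHundredFiftyThree_of_char_547 K
  · exact not_holdsInDegree_of_choose_modEq_one K 547 (d := 354) (m := 86) (by norm_num) (by norm_num) (by decide)
  · exact not_holdsInDegree_threeHundredFiftyFive_of_char_547 K
  · exact not_holdsInDegree_threeHundredFiftySix_of_char_547 K
  · exact not_holdsInDegree_of_choose_modEq_one K 547 (d := 357) (m := 3) (by norm_num) (by norm_num) (by decide)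
  · exact not_holdsInDegree_threeHundredFiftyEight_of_char_547 K
  · exact not_holdsInDegree_threeHundredFiftyNine_of_char_547 K
  · exact not_holdsInDegree_of_choose_modEq_one K 547 (d := 360) (m := 118) (by norm_num) (by norm_num) (by decide)
  · exact not_holdsInDegree_threeHundredSixtyOne_of_char_547 K
  · exact not_holdsInDegree_threeHundredSixtyTwo_of_char_547 K
  · exact not_holdsInDegree_of_choose_modEq_one K 547 (d := 363) (m := 180) (by norm_num) (by norm_num) (by decide)
  · exact not_holdsInDegree_threeHundredSixtyFour_of_char_547 K
  · exact not_holdsInDegree_threeHundredSixtyFive_of_char_547 K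
  · exact not_holdsInDegree_threeHundredSixtySix_of_char_547 K
  · exact not_holdsInDegree_threeHundredSixtySeven_of_char_547 K
  · exact not_holdsInDegree_threeHundredSixtyEight_of_char_547 K
  · exact not_holdsInDegree_threeHundredSixtyNine_of_char_547 K
  · exact not_holdsInDegree_threeHundredSeventy_of_char_547 K
  · exact not_holdsInDegree_of_choose_modEq_one K 547 (d := 371) (m := 87) (by norm_num) (by norm_num) (by decide)
  · exact not_holdsInDegree_threeHundredSeventyTwo_of_char_547 K
  · exact not_holdsInDegree_of_choose_modEq_one K 547 (d := 373) (m := 70) (by norm_num) (by norm_num) (by decide)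
  · exact not_holdsInDegree_threeHundredSeventyFour_of_char_547 K
  · exact not_holdsInDegree_of_choose_modEq_one K 547 (d := 375) (m := 152) (by norm_num) (by norm_num) (by decide)
  · exact not_holdsInDegree_threeHundredSeventySix_of_char_547 K
  · exact not_holdsInDegree_threeHundredSeventySeven_of_char_547 K
  · exact not_holdsInDegree_threeHundredSeventyEight_of_char_547 K
  · exact not_holdsInDegree_threeHundredSeventyNine_of_char_547 K
  · exact not_holdsInDegree_of_choose_modEq_one K 547 (d := 380) (m := 123) (by norm_num) (by norm_num) (by decide)
  · exact not_holdsInDegree_threeHundredEightyOne_of_char_547 K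
  · exact not_holdsInDegree_threeHundredEightyTwo_of_char_547 K
  · exact not_holdsInDegree_threeHundredEightyThree_of_char_547 K
  · exact not_holdsInDegree_threeHundredEightyFour_of_char_547 K
  · exact not_holdsInDegree_of_choose_modEq_one K 547 (d := 385) (m := 135) (by norm_num) (by norm_num) (by decide)
  · exact not_holdsInDegree_threeHundredEightySix_of_char_547 K
  · exact not_holdsInDegree_of_choose_modEq_one K 547 (d := 387) (m := 53) (by norm_num) (by norm_num) (by decide)
  · exact not_holdsInDegree_threeHundredEightyEight_of_char_547 K
  · exact not_holdsInDegree_threeHundredEightyNine_of_char_547 K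
  · exact not_holdsInDegree_threeHundredNinety_of_char_547 K
  · exact not_holdsInDegree_threeHundredNinetyOne_of_char_547 K
  · exact not_holdsInDegree_threeHundredNinetyTwo_of_char_547 K
  · exact not_holdsInDegree_threeHundredNinetyThree_of_char_547 K
  · exact not_holdsInDegree_threeHundredNinetyFour_of_char_547 K
  · exact not_holdsInDegree_threeHundredNinetyFive_of_char_547 K
  · exact not_holdsInDegree_threeHundredNinetySix_of_char_547 K
  · exact not_holdsInDegree_threeHundredNinetySeven_of_char_547 K
  · exact not_holdsInDegree_threeHundredNinetyEight_of_char_547 K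
  · exact not_holdsInDegree_of_choose_modEq_one K 547 (d := 399) (m := 56) (by norm_num) (by norm_num) (by decide)
  · exact not_holdsInDegree_fourHundred_of_char_547 K
  · exact not_holdsInDegree_fourHundredOne_of_char_547 K
  · exact not_holdsInDegree_fourHundredTwo_of_char_547 K
  · exact not_holdsInDegree_fourHundredThree_of_char_547 K
  · exact not_holdsInDegree_fourHundredFour_of_char_547 K
  · exact not_holdsInDegree_fourHundredFive_of_char_547 K
  · exact not_holdsInDegree_of_choose_modEq_one K 547 (d := 406) (m := 24) (by norm_num) (by norm_num) (by decide)
  · exact not_holdsInDegree_of_choose_modEq_one K 547 (d := 407) (m := 200) (by norm_num) (by norm_num) (by decide)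
  · exact not_holdsInDegree_fourHundredEight_of_char_547 K
  · exact not_holdsInDegree_of_choose_modEq_one K 547 (d := 409) (m := 44) (by norm_num) (by norm_num) (by decide)
  · exact not_holdsInDegree_fourHundredTen_of_char_547 K
  · exact not_holdsInDegree_of_choose_modEq_one K 547 (d := 411) (m := 21) (by norm_num) (by norm_num) (by decide)
  · exact not_holdsInDegree_fourHundredTwelve_of_char_547 K
  · exact not_holdsInDegree_fourHundredThirteen_of_char_547 K
  · exact not_holdsInDegree_fourHundredFourteen_of_char_547 K
  · exact not_holdsInDegree_fourHundredFifteen_of_char_547 K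
  · exact not_holdsInDegree_fourHundredSixteen_of_char_547 K
  · exact not_holdsInDegree_fourHundredSeventeen_of_char_547 K
  · exact not_holdsInDegree_fourHundredEighteen_of_char_547 K
  · exact not_holdsInDegree_fourHundredNineteen_of_char_547 K
  · exact not_holdsInDegree_fourHundredTwenty_of_char_547 K
  · exact not_holdsInDegree_fourHundredTwentyOne_of_char_547 K
  · exact not_holdsInDegree_fourHundredTwentyTwo_of_char_547 K
  · exact not_holdsInDegree_fourHundredTwentyThree_of_char_547 K
  · exact not_holdsInDegree_fourHundredTwentyFour_of_char_547 K
  · exact not_holdsInDegree_fourHundredTwentyFive_of_char_547 K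
  · exact not_holdsInDegree_fourHundredTwentySix_of_char_547 K
  · exact not_holdsInDegree_of_choose_modEq_one K 547 (d := 427) (m := 34) (by norm_num) (by norm_num) (by decide)
  · exact not_holdsInDegree_of_choose_modEq_one K 547 (d := 428) (m := 186) (by norm_num) (by norm_num) (by decide)
  · exact not_holdsInDegree_fourHundredTwentyNine_of_char_547 K
  · exact not_holdsInDegree_fourHundredThirty_of_char_547 K
  · exact not_holdsInDegree_of_choose_modEq_one K 547 (d := 431) (m := 166) (by norm_num) (by norm_num) (by decide)
  · exact not_holdsInDegree_fourHundredThirtyTwo_of_char_547 K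
  · exact not_holdsInDegree_fourHundredThirtyThree_of_char_547 K
  · exact not_holdsInDegree_fourHundredThirtyFour_of_char_547 K
  · exact not_holdsInDegree_fourHundredThirtyFive_of_char_547 K
  · exact not_holdsInDegree_fourHundredThirtySix_of_char_547 K
  · exact not_holdsInDegree_of_choose_modEq_one K 547 (d := 437) (m := 18) (by norm_num) (by norm_num) (by decide)
  · exact not_holdsInDegree_of_choose_modEq_one K 547 (d := 438) (m := 73) (by norm_num) (by norm_num) (by decide)
  · exact not_holdsInDegree_of_choose_modEq_one K 547 (d := 439) (m := 128) (by norm_num) (by norm_num) (by decide)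
  · exact not_holdsInDegree_fourHundredForty_of_char_547 K
  · exact not_holdsInDegree_fourHundredFortyOne_of_char_547 K
  · exact not_holdsInDegree_fourHundredFortyTwo_of_char_547 K
  · exact not_holdsInDegree_fourHundredFortyThree_of_char_547 K
  · exact not_holdsInDegree_fourHundredFortyFour_of_char_547 K
  · exact not_holdsInDegree_of_choose_modEq_one K 547 (d := 445) (m := 150) (by norm_num) (by norm_num) (by decide)
  · exact not_holdsInDegree_fourHundredFortySix_of_char_547 K
  · exact not_holdsInDegree_fourHundredFortySeven_of_char_547 K
  · exact not_holdsInDegree_fourHundredFortyEight_of_char_547 K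
  · exact not_holdsInDegree_fourHundredFortyNine_of_char_547 K
  · exact not_holdsInDegree_fourHundredFifty_of_char_547 K
  · exact not_holdsInDegree_fourHundredFiftyOne_of_char_547 K
  · exact not_holdsInDegree_of_choose_modEq_one K 547 (d := 452) (m := 21) (by norm_num) (by norm_num) (by decide)
  · exact not_holdsInDegree_fourHundredFiftyThree_of_char_547 K
  · exact not_holdsInDegree_fourHundredFiftyFour_of_char_547 K
  · exact not_holdsInDegree_fourHundredFiftyFive_of_char_547 K
  · exact not_holdsInDegree_fourHundredFiftySix_of_char_547 K
  · exact not_holdsInDegree_of_choose_modEq_one K 547 (d := 457) (m := 49) (by norm_num) (by norm_num) (by decide)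
  · exact not_holdsInDegree_fourHundredFiftyEight_of_char_547 K
  · exact not_holdsInDegree_of_choose_modEq_one K 547 (d := 459) (m := 175) (by norm_num) (by norm_num) (by decide)
  · exact not_holdsInDegree_of_choose_modEq_one K 547 (d := 460) (m := 192) (by norm_num) (by norm_num) (by decide)
  · exact not_holdsInDegree_fourHundredSixtyOne_of_char_547 K
  · exact not_holdsInDegree_of_choose_modEq_one K 547 (d := 462) (m := 68) (by norm_num) (by norm_num) (by decide)
  · exact not_holdsInDegree_fourHundredSixtyThree_of_char_547 K
  · exact not_holdsInDegree_fourHundredSixtyFour_of_char_547 K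
  · exact not_holdsInDegree_fourHundredSixtyFive_of_char_547 K
  · exact not_holdsInDegree_fourHundredSixtySix_of_char_547 K
  · exact not_holdsInDegree_fourHundredSixtySeven_of_char_547 K
  · exact not_holdsInDegree_fourHundredSixtyEight_of_char_547 K
  · exact not_holdsInDegree_of_choose_modEq_one K 547 (d := 469) (m := 116) (by norm_num) (by norm_num) (by decide)
  · exact not_holdsInDegree_of_choose_modEq_one K 547 (d := 470) (m := 97) (by norm_num) (by norm_num) (by decide)
  · exact not_holdsInDegree_fourHundredSeventyOne_of_char_547 K
  · exact not_holdsInDegree_fourHundredSeventyTwo_of_char_547 K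
  · exact not_holdsInDegree_fourHundredSeventyThree_of_char_547 K
  · exact not_holdsInDegree_fourHundredSeventyFour_of_char_547 K
  · exact not_holdsInDegree_fourHundredSeventyFive_of_char_547 K
  · exact not_holdsInDegree_of_choose_modEq_one K 547 (d := 476) (m := 119) (by norm_num) (by norm_num) (by decide)
  · exact not_holdsInDegree_fourHundredSeventySeven_of_char_547 K
  · exact not_holdsInDegree_of_choose_modEq_one K 547 (d := 478) (m := 84) (by norm_num) (by norm_num) (by decide)
  · exact not_holdsInDegree_fourHundredSeventyNine_of_char_547 K
  · exact not_holdsInDegree_fourHundredEighty_of_char_547 K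
  · exact not_holdsInDegree_fourHundredEightyOne_of_char_547 K
  · exact not_holdsInDegree_of_choose_modEq_one K 547 (d := 482) (m := 32) (by norm_num) (by norm_num) (by decide)
  · exact not_holdsInDegree_fourHundredEightyThree_of_char_547 K
  · exact not_holdsInDegree_fourHundredEightyFour_of_char_547 K
  · exact not_holdsInDegree_fourHundredEightyFive_of_char_547 K
  · exact not_holdsInDegree_fourHundredEightySix_of_char_547 K
  · exact not_holdsInDegree_fourHundredEightySeven_of_char_547 K
  · exact not_holdsInDegree_fourHundredEightyEight_of_char_547 K
  · exact not_holdsInDegree_fourHundredEightyNine_of_char_547 K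
  · exact not_holdsInDegree_fourHundredNinety_of_char_547 K
  · exact not_holdsInDegree_fourHundredNinetyOne_of_char_547 K
  · exact not_holdsInDegree_fourHundredNinetyTwo_of_char_547 K
  · exact not_holdsInDegree_of_choose_modEq_one K 547 (d := 493) (m := 159) (by norm_num) (by norm_num) (by decide)
  · exact not_holdsInDegree_of_choose_modEq_one K 547 (d := 494) (m := 226) (by norm_num) (by norm_num) (by decide)
  · exact not_holdsInDegree_fourHundredNinetyFive_of_char_547 K
  · exact not_holdsInDegree_of_choose_modEq_one K 547 (d := 496) (m := 198) (by norm_num) (by norm_num) (by decide)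
  · exact not_holdsInDegree_of_choose_modEq_one K 547 (d := 497) (m := 89) (by norm_num) (by norm_num) (by decide)
  · exact not_holdsInDegree_of_choose_modEq_one K 547 (d := 498) (m := 117) (by norm_num) (by norm_num) (by decide)
  · exact not_holdsInDegree_fourHundredNinetyNine_of_char_547 K
  · exact not_holdsInDegree_fiveHundred_of_char_547 K
  · exact not_holdsInDegree_of_choose_modEq_one K 547 (d := 501) (m := 182) (by norm_num) (by norm_num) (by decide)
  · exact not_holdsInDegree_fiveHundredTwo_of_char_547 K
  · exact not_holdsInDegree_fiveHundredThree_of_char_547 K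
  · exact not_holdsInDegree_of_choose_modEq_one K 547 (d := 504) (m := 181) (by norm_num) (by norm_num) (by decide)
  · exact not_holdsInDegree_fiveHundredFive_of_char_547 K
  · exact not_holdsInDegree_fiveHundredSix_of_char_547 K
  · exact not_holdsInDegree_of_choose_modEq_one K 547 (d := 507) (m := 227) (by norm_num) (by norm_num) (by decide)
  · exact not_holdsInDegree_of_choose_modEq_one K 547 (d := 508) (m := 222) (by norm_num) (by norm_num) (by decide)
  · exact not_holdsInDegree_fiveHundredNine_of_char_547 K
  · exact not_holdsInDegree_fiveHundredTen_of_char_547 K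
  · exact not_holdsInDegree_fiveHundredEleven_of_char_547 K
  · exact not_holdsInDegree_fiveHundredTwelve_of_char_547 K
  · exact not_holdsInDegree_fiveHundredThirteen_of_char_547 K
  · exact not_holdsInDegree_of_choose_modEq_one K 547 (d := 514) (m := 64) (by norm_num) (by norm_num) (by decide)
  · exact not_holdsInDegree_fiveHundredFifteen_of_char_547 K
  · exact not_holdsInDegree_fiveHundredSixteen_of_char_547 K
  · exact not_holdsInDegree_fiveHundredSeventeen_of_char_547 K
  · exact not_holdsInDegree_of_choose_modEq_one K 547 (d := 518) (m := 53) (by norm_num) (by norm_num) (by decide)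
  · exact not_holdsInDegree_fiveHundredNineteen_of_char_547 K
  · exact not_holdsInDegree_fiveHundredTwenty_of_char_547 K
  · exact not_holdsInDegree_of_choose_modEq_one K 547 (d := 521) (m := 227) (by norm_num) (by norm_num) (by decide)
  · exact not_holdsInDegree_of_choose_modEq_one K 547 (d := 522) (m := 140) (by norm_num) (by norm_num) (by decide)
  · exact not_holdsInDegree_fiveHundredTwentyThree_of_char_547 K
  · exact not_holdsInDegree_fiveHundredTwentyFour_of_char_547 K
  · exact not_holdsInDegree_of_choose_modEq_one K 547 (d := 525) (m := 135) (by norm_num) (by norm_num) (by decide)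
  · exact not_holdsInDegree_fiveHundredTwentySix_of_char_547 K
  · exact not_holdsInDegree_fiveHundredTwentySeven_of_char_547 K
  · exact not_holdsInDegree_fiveHundredTwentyEight_of_char_547 K
  · exact not_holdsInDegree_of_choose_modEq_one K 547 (d := 529) (m := 74) (by norm_num) (by norm_num) (by decide)
  · exact not_holdsInDegree_fiveHundredThirty_of_char_547 K
  · exact not_holdsInDegree_fiveHundredThirtyOne_of_char_547 K
  · exact not_holdsInDegree_fiveHundredThirtyTwo_of_char_547 K
  · exact not_holdsInDegree_of_choose_modEq_one K 547 (d := 533) (m := 192) (by norm_num) (by norm_num) (by decide)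
  · exact not_holdsInDegree_of_choose_modEq_one K 547 (d := 534) (m := 237) (by norm_num) (by norm_num) (by decide)
  · exact not_holdsInDegree_fiveHundredThirtyFive_of_char_547 K
  · exact not_holdsInDegree_of_choose_modEq_one K 547 (d := 536) (m := 209) (by norm_num) (by norm_num) (by decide)
  · exact not_holdsInDegree_fiveHundredThirtySeven_of_char_547 K
  · exact not_holdsInDegree_fiveHundredThirtyEight_of_char_547 K
  · exact not_holdsInDegree_fiveHundredThirtyNine_of_char_547 K
  · exact not_holdsInDegree_fiveHundredForty_of_char_547 K
  · exact not_holdsInDegree_of_choose_modEq_one K 547 (d := 541) (m := 249) (by norm_num) (by norm_num) (by decide)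
  · exact not_holdsInDegree_fiveHundredFortyTwo_of_char_547 K
  · exact not_holdsInDegree_of_choose_modEq_one K 547 (d := 543) (m := 189) (by norm_num) (by norm_num) (by decide)
  · exact not_holdsInDegree_fiveHundredFortyFour_of_char_547 K
  · exact not_holdsInDegree_fiveHundredFortyFive_of_char_547 K
  · exact not_holdsInDegree_of_choose_modEq_one K 547 (d := 546) (m := 2) (by norm_num) (by norm_num) (by decide)

/-- the positive digits `1 ≤ a ≤ 5`: `CA_{a·547^k}` over every field of characteristic `547`. [cite: GrafVonBothmerEtAl2007, Props. 2, 6]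
[cite: CastryckLaterveerOunaies2012, Thm. 4] -/
theorem holdsInDegree_mul_fiveHundredFortySeven_pow_of_le_five' {a : ℕ} (ha0 : 0 < a) (ha5 : a ≤ 5) (k : ℕ) :
    HoldsInDegree K (a * 547 ^ k) := by
  haveI : Fact (Nat.Prime 547) := ⟨by norm_num⟩
  interval_cases a
  · simpa using holdsInDegree_prime_pow_field K 547 k
  · exact holdsInDegree_two_mul_prime_pow_field K 547 k
  · exact holdsInDegree_three_mul_prime_pow_field K 547 (by norm_num) k
  · exact holdsInDegree_mul_prime_pow_field K 547
      (holdsInDegree_of_le_four_of_charP (AlgebraicClosure K) 547 (by norm_num) le_rfl) k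
  · exact holdsInDegree_five_mul_prime_pow_field K 547 (by norm_num) (by norm_num) (by norm_num) (by norm_num)
      (by norm_num) (by norm_num) (by norm_num) (by norm_num) (by norm_num) k

/-- **characteristic 547, away from the digit `8`**: over every field of characteristic `547` and for every `d ≠ 8·547^k`,
`CA_d ⟺ d = 0 ∨ d = a·547^k` with `1 ≤ a ≤ 7`.  (The degrees `8·547^k` are excluded by hypothesis: no `𝔽_547`-rational-witness
Casas-Alvero octic exists, so the digit `8` is neither refuted nor certified here.) [cite: GrafVonBothmerEtAl2007, Props. 2, 6, 7]
[cite: CastryckLaterveerOunaies2012, Thm. 4] -/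
theorem classification_char_fiveHundredFortySeven_partial (d : ℕ) (hd : ∀ k : ℕ, d ≠ 8 * 547 ^ k) :
    HoldsInDegree K d ↔ d = 0 ∨ ∃ k a : ℕ, 0 < a ∧ a ≤ 7 ∧ d = a * 547 ^ k := by
  haveI : Fact (Nat.Prime 547) := ⟨by norm_num⟩
  constructor
  · intro h
    rcases Nat.eq_zero_or_pos d with rfl | hd0
    · exact Or.inl rfl
    obtain ⟨k, a, ha0, hap, rfl, ha⟩ := digit_of_holdsInDegree K 547 hd0.ne' h
    refine Or.inr ⟨k, a, ha0, ?_, rfl⟩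
    by_contra hN
    rcases Nat.lt_or_ge a 9 with hlo | hlo
    · obtain rfl : a = 8 := by omega
      exact hd k rfl
    · by_cases h8 : a = 8
      · subst h8
        exact hd k rfl
      · exact not_holdsInDegree_digit_of_char_fiveHundredFortySeven' K hlo hap h8 ha
  · rintro (rfl | ⟨k, a, ha0, haN, rfl⟩)
    · exact holdsInDegree_zero K
    · rcases Nat.lt_or_ge a 6 with ha | ha
      · exact holdsInDegree_mul_fiveHundredFortySeven_pow_of_le_five' K ha0 (by omega) k
      · rcases Nat.lt_or_ge a 7 with ha' | ha'
        · obtain rfl : a = 6 := by omega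
          exact holdsInDegree_six_mul_pow_of_char_547' K k
        · obtain rfl : a = 7 := le_antisymm haN ha'
          exact holdsInDegree_seven_mul_pow_of_char_547 (K := K) k

/-- **characteristic 547, complete GIVEN `CA_8`**: if the Casas-Alvero property holds over `K` in the degrees `8·547^k` (for instance once `547` is
certified a good prime of degree `8`, cf. the module docstring — nothing of the kind is proved in this tree), then `CA_d(K) ⟺ d = 0 ∨ d = a·547^k` with
`1 ≤ a ≤ 8`. [cite: GrafVonBothmerEtAl2007, Props. 2, 6, 7] [cite: CastryckLaterveerOunaies2012, Thm. 4] -/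
theorem classification_char_fiveHundredFortySeven_of_degree_eight (h8 : ∀ k : ℕ, HoldsInDegree K (8 * 547 ^ k)) (d : ℕ) :
    HoldsInDegree K d ↔ d = 0 ∨ ∃ k a : ℕ, 0 < a ∧ a ≤ 8 ∧ d = a * 547 ^ k := by
  haveI : Fact (Nat.Prime 547) := ⟨by norm_num⟩
  constructor
  · intro h
    rcases Nat.eq_zero_or_pos d with rfl | hd0
    · exact Or.inl rfl
    obtain ⟨k, a, ha0, hap, rfl, ha⟩ := digit_of_holdsInDegree K 547 hd0.ne' h
    refine Or.inr ⟨k, a, ha0, ?_, rfl⟩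
    by_contra hN
    rcases Nat.lt_or_ge a 9 with hlo | hlo
    · exact hN (by omega)
    · by_cases h8' : a = 8
      · exact hN (by omega)
      · exact not_holdsInDegree_digit_of_char_fiveHundredFortySeven' K hlo hap h8' ha
  · rintro (rfl | ⟨k, a, ha0, haN, rfl⟩)
    · exact holdsInDegree_zero K
    · rcases Nat.lt_or_ge a 6 with ha | ha
      · exact holdsInDegree_mul_fiveHundredFortySeven_pow_of_le_five' K ha0 (by omega) k
      · rcases Nat.lt_or_ge a 7 with ha' | ha'
        · obtain rfl : a = 6 := by omega
          exact holdsInDegree_six_mul_pow_of_char_547' K k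
        · rcases Nat.lt_or_ge a 8 with ha'' | ha''
          · obtain rfl : a = 7 := by omega
            exact holdsInDegree_seven_mul_pow_of_char_547 (K := K) k
          · obtain rfl : a = 8 := le_antisymm haN ha''
            exact h8 k

/-- **characteristic 547, complete GIVEN `¬CA_8`**: if the Casas-Alvero property FAILS over `K` in degree `8`, then (leading-digit reduction, forward half,
any field) it fails in every degree `8·547^k` and `CA_d(K) ⟺ d = 0 ∨ d = a·547^k` with `1 ≤ a ≤ 7`. [cite: GrafVonBothmerEtAl2007, Props. 2, 6, 7]
[cite: CastryckLaterveerOunaies2012, Thm. 4] -/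
theorem classification_char_fiveHundredFortySeven_of_not_degree_eight (h8 : ¬ HoldsInDegree K 8) (d : ℕ) :
    HoldsInDegree K d ↔ d = 0 ∨ ∃ k a : ℕ, 0 < a ∧ a ≤ 7 ∧ d = a * 547 ^ k := by
  haveI : Fact (Nat.Prime 547) := ⟨by norm_num⟩
  constructor
  · intro h
    rcases Nat.eq_zero_or_pos d with rfl | hd0
    · exact Or.inl rfl
    obtain ⟨k, a, ha0, hap, rfl, ha⟩ := digit_of_holdsInDegree K 547 hd0.ne' h
    refine Or.inr ⟨k, a, ha0, ?_, rfl⟩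
    by_contra hN
    rcases Nat.lt_or_ge a 9 with hlo | hlo
    · obtain rfl : a = 8 := by omega
      exact h8 ha
    · by_cases h8' : a = 8
      · subst h8'
        exact h8 ha
      · exact not_holdsInDegree_digit_of_char_fiveHundredFortySeven' K hlo hap h8' ha
  · rintro (rfl | ⟨k, a, ha0, haN, rfl⟩)
    · exact holdsInDegree_zero K
    · rcases Nat.lt_or_ge a 6 with ha | ha
      · exact holdsInDegree_mul_fiveHundredFortySeven_pow_of_le_five' K ha0 (by omega) k
      · rcases Nat.lt_or_ge a 7 with ha' | ha'
        · obtain rfl : a = 6 := by omega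
          exact holdsInDegree_six_mul_pow_of_char_547' K k
        · obtain rfl : a = 7 := le_antisymm haN ha'
          exact holdsInDegree_seven_mul_pow_of_char_547 (K := K) k

/-- the set of Casas-Alvero degrees `≤ 299209` other than `8` and `8·547 = 4376` in characteristic `547`, explicitly (corollary of the classification away
from the digit `8`: [cite: GrafVonBothmerEtAl2007, Prop. 6] with [cite: CastryckLaterveerOunaies2012, Thm. 4] and the digit refutations above). -/
theorem holdsInDegree_iff_mem_of_le_char_fiveHundredFortySeven_sq' {d : ℕ} (hd : d ≤ 299209) (h8 : d ≠ 8) (h8p : d ≠ 4376) :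
    HoldsInDegree K d ↔ d ∈ ({0, 1, 2, 3, 4, 5, 6, 7, 547, 1094, 1641, 2188, 2735, 3282, 3829, 299209} : Finset ℕ) := by
  have hd' : ∀ k : ℕ, d ≠ 8 * 547 ^ k := by
    intro k
    rcases k with _ | _ | k
    · simpa using h8
    · simpa using h8p
    · intro h
      have : 547 ^ 2 ≤ 547 ^ (k + 1 + 1) := Nat.pow_le_pow_right (by norm_num) (by omega)
      omega
  rw [classification_char_fiveHundredFortySeven_partial K d hd']
  constructor
  · rintro (rfl | ⟨k, a, ha0, haN, rfl⟩)
    · decide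
    · rcases k with _ | _ | _ | k
      · interval_cases a <;> decide
      · interval_cases a <;> decide
      · interval_cases a <;> simp_all
      · exfalso
        have : 547 ^ 3 ≤ a * 547 ^ (k + 1 + 1 + 1) :=
          le_trans (Nat.pow_le_pow_right (by norm_num) (by omega)) (Nat.le_mul_of_pos_left _ ha0)
        omega
  · intro h
    simp only [Finset.mem_insert, Finset.mem_singleton] at h
    rcases h with rfl | rfl | rfl | rfl | rfl | rfl | rfl | rfl | rfl | rfl | rfl | rfl | rfl | rfl | rfl | rfl
    · exact Or.inl rfl
    · exact Or.inr ⟨0, 1, by norm_num, by norm_num, by norm_num⟩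
    · exact Or.inr ⟨0, 2, by norm_num, by norm_num, by norm_num⟩
    · exact Or.inr ⟨0, 3, by norm_num, by norm_num, by norm_num⟩
    · exact Or.inr ⟨0, 4, by norm_num, by norm_num, by norm_num⟩
    · exact Or.inr ⟨0, 5, by norm_num, by norm_num, by norm_num⟩
    · exact Or.inr ⟨0, 6, by norm_num, by norm_num, by norm_num⟩
    · exact Or.inr ⟨0, 7, by norm_num, by norm_num, by norm_num⟩
    · exact Or.inr ⟨1, 1, by norm_num, by norm_num, by norm_num⟩
    · exact Or.inr ⟨1, 2, by norm_num, by norm_num, by norm_num⟩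
    · exact Or.inr ⟨1, 3, by norm_num, by norm_num, by norm_num⟩
    · exact Or.inr ⟨1, 4, by norm_num, by norm_num, by norm_num⟩
    · exact Or.inr ⟨1, 5, by norm_num, by norm_num, by norm_num⟩
    · exact Or.inr ⟨1, 6, by norm_num, by norm_num, by norm_num⟩
    · exact Or.inr ⟨1, 7, by norm_num, by norm_num, by norm_num⟩
    · exact Or.inr ⟨2, 1, by norm_num, by norm_num, by norm_num⟩

end CharFiveHundredFortySevenPartial

end Literature.Algebra.Polynomial.CasasAlvero
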